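/-
Copyright (c) 2026 the pub-hodgecm-mathlib formalisation cell (harness21).  Prover seat hodgecm-mathlib-LH4-p09 (g4): Track A «(D-RAM) FOUR-FRAME» squad of crux H413, unit U2H (ii-H),
ROW (2) census leaf (ρ2b′-X) — payer LH4-p14 (g3) ORDER v1 organ **O-Hside**, the «LEAN LEG» (bus 2026-09-04T04:08:25Z (3)): the H-SIDE count of :418 read as a LATTICE count, 2026-09-04.
-/
import Literature.NumberTheory.Rogawski1990.UnitaryTwoLocalNonsplitDictionaryCM              -- ★ p857… (K2E3-p23): `placeForm_antidiagTwo_eq_over`, `coe_localNonsplitEquiv_two_mem`; brings ★ `localNonsplitEquiv`, `cmDatum`, `cmLocalIntegralLevel`, ★ `mem_localIntegralLevel_iff_of_smul_eq`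
import Literature.NumberTheory.Automorphic.UnitaryThreeFourFrameFixedCosetDictionary           -- ★ p854559∕… (LH4-p03): THE UNLABELLED ORBIT DICTIONARY `natCard_fixedBy_quotient_eq_ncard_orbit` (any rank, any group)
import Literature.NumberTheory.Automorphic.UnitaryLatticeTreeFixedCosetStrataDictionary         -- ★ (B-p14): `mapGL_stdLattice_eq_iff_mem_glInt` (`k·𝒪^N = 𝒪^N ↔ k ∈ GL_N(𝒪)`)
import Literature.NumberTheory.Automorphic.UnitaryGroupInertPlaceHyperbolicBasis               -- ★ `galAdicCompletionMap_galAdicCompletionMap_of_smul_eq` (`σ_w² = 1`)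
import Literature.NumberTheory.Automorphic.UnitaryLatticeTreeSelfDualTransitiveTwoEven          -- ★ (this seat, brick 1): `setOf_orbit_stdLattice_two_eq_setOf_isSelfDualLattice_even` (the orbit `U(σ,J₂)·𝒪²` = the EVEN self-dual lattices, 2-free)
import HarnessLib

/-!
# F0 · P3c · line LH4 «(D-RAM) FOUR-FRAME» — unit (ii-H), leaf (ρ2b′-X), organ O-Hside «LEAN LEG»: THE H-SIDE COUNT `#Fix_{γ₂}(U₂(L⁺_v) ⧸ K₂)` IS THE NUMBER OF `γ₂`-FIXED
# EVEN SELF-DUAL LATTICES OF THE HYPERBOLIC PLANE `(E_w², Φ₂)` (Kottwitz 1986 §3; Rogawski 1990 §4.9; Jacobowitz 1962 §9)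

Cell `pub/hodgecm-mathlib` (D-0151), crux H413 = `stmt-HodgeConjecture-24833` (helper lane `--supports stmt-HodgeConjecture-24833 --as helper`, count-neutral); THEOREMS ONLY (no
definition, no instance, no notation, no named fact, no `sorry`, default heartbeats).  Tree socket served: (ρ2b′-X) `stub_U2H_fixedPointCensus_typeTwo_unit0` of
`Cruxes/H413/Lines/F0_P3c_DyRamFourFrame_U2H_HSide.lean` (ED. 15, :418) — its RIGHT-HAND SIDE carries the H-side token
`Nat.card (MulAction.fixedBy ((U₂.Local v) ⧸ cmLocalIntegralLevel L 2 Φ₂ v) γH.1)` (★ p856225 `F0P3cDyRamHProfilesTypeTwoVertexCount` §3 put it there, binder-free).  Payer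
LH4-p14 (g3) ORDER v1 (`F0/P3c/LH4/LH4-p14/g3/RHO2BX-ORDER.v1.LH4p14g3.md`) row O-Hside; the descent ∕ `SL₂`-level sentence (`n_H`) stays with F0P3a-p01 (g32) (T3-E).

WHAT IS PROVED — the rank-2 twin of layer 1 ★ p857061 `F0P3cDyRamFixedPointCensusTypeTwoLattice` (there: `#Fix_δ(G_v ⧸ K_t)` ↦ `#{M ⊂ E_w³ self-dual : ι_w(δ)·M = M}` for an ABSTRACT
root stabiliser `K_t`, using TRANSITIVITY of `U(Φ₃)` on self-dual lattices, true in rank 3 at every ramified place ★ `…SelfDualTransitiveWildCM`).  In rank 2 the level group is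
the CONCRETE `K₂ = cmLocalIntegralLevel L 2 Φ₂ v = U(Φ₂)(𝒪_v)` and `U(Φ₂)(E_w)` is NOT transitive on all self-dual lattices of the hyperbolic plane at a wildly ramified place
(`[[0,1],[1,a]]`, `a ∉ Tr 𝒪_w`) — so the dictionary is stated on the ORBIT and the orbit is named intrinsically:
* §1 `mem_cmLocalIntegralLevel_two_iff_mapGL_stdLattice_eq` — `u ∈ K₂ ⟺ ι_w(u)·𝒪_w² = 𝒪_w²` (★ `mem_localIntegralLevel_iff_of_smul_eq` + ★ `mapGL_stdLattice_eq_iff_mem_glInt`), and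
  **`natCard_fixedBy_quotient_cmLocalIntegralLevel_two_eq_ncard_orbit`** — `#Fix_γ(U₂(L⁺_v) ⧸ K₂) = #{B ⊂ E_w² | B ∈ ι_w(U₂(L⁺_v))·𝒪_w² ∧ ι_w(γ)·B = B}` for EVERY `γ ∈ U₂(L⁺_v)` at
  every non-split place (★ Kottwitz's orbit dictionary `natCard_fixedBy_quotient_eq_ncard_orbit` at `ι_w = localNonsplitEquiv`, `N₀ = 𝒪_w²`; both sides `0` if infinite).
* §2 **HEAD `natCard_fixedBy_quotient_cmLocalIntegralLevel_two_eq_ncard_even_selfDual_fixed`** — for a uniformiser `ϖ` of `E_w`: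
  `#Fix_γ(U₂(L⁺_v) ⧸ K₂) = #{B ⊂ E_w² | B self-dual for (σ_w, ϖ, J₂) ∧ B EVEN ∧ ι_w(γ)·B = B}`, EVEN meaning `∀ y ∈ B, ⟨y,y⟩ = s + σ_w s` for some `|s| ≤ 1` — ★ brick 1
  `setOf_orbit_stdLattice_two_eq_setOf_isSelfDualLattice_even` (the orbit of `𝒪_w²` under `U(σ_w, J₂)(E_w)` is exactly the even self-dual lattices; 2-free, `d`-free) at the onto map
  `ι_w : U₂(L⁺_v) ≃ U(σ_w, (Φ₂)_w)`, `(Φ₂)_w = J₂` (★ `placeForm_antidiagTwo_eq_over`), `σ_w² = 1`, `|σ_w ·| = |·|`.  This is the currency in which the W-side organs (O-W ∕ O-Ax ∕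
  O-Cone: ★ `EllipticPlaneAsFieldLine`, ★ `UnitaryLatticeTreeBlockGlue*`) count `g`-fixed self-dual `W`-lattices; the EVEN ∕ ODD split of those (ORDER v1 C1: «even(+) + d%2 = N_V»)
  is the head's bookkeeping, not this file's.

HONEST LABEL: HC_CM is proved only modulo the 7 printed citations (2 remaining named inputs: hLiu418 = stmt-HodgeConjecture-24832, h413 = stmt-HodgeConjecture-24833) until rung 0
closes; this file is a DICTIONARY (count-neutral) — it does NOT assert (ρ2b′-X), which stays an open, κ-gated prover target (kit-confirmed law, j348104).

## References
* [Kottwitz1986BaseChangeUnits] R. E. Kottwitz, *Base change for unit elements of Hecke algebras*, Compositio Math. 60 (1986), §3 (orbital integrals of units as fixed-lattice counts).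
* [Rogawski1990] J. D. Rogawski, *Automorphic Representations of Unitary Groups in Three Variables*, Ann. of Math. Stud. 123 (1990), §4.9 Prop. 4.9.1 (b) p. 55, Lemma 4.9.3
  p. 56 (the `H`-side terms of the fundamental lemma near `1`); §1.9 p. 8 (`U(2)`, `Φ₂`).
* [Jacobowitz1962] R. Jacobowitz, *Hermitian forms over local fields*, Amer. J. Math. 84 (1962), §9 Prop. 9.1 (a unimodular plane is hyperbolic iff its norm ideal lies in `nH(0)`).
* [PlatonovRapinchuk1994] V. Platonov, A. Rapinchuk, *Algebraic Groups and Number Theory* (1994), §5.1 (`U(J)(F_v) = U(σ_w, J)(E_w)`, `U(J)(𝒪_v) ↔ GL_N(𝒪_w)` at a non-split place).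
-/

set_option autoImplicit false

noncomputable section

namespace Summit.HodgeConjecture.HodgeConjecture.Cruxes.H413.F0P3cDyRamHSideLatticeCount

open MeasureTheory Measure NumberField IsDedekindDomain Topology Filter
open Literature.NumberTheory.Automorphic Literature.NumberTheory.Automorphic.UnitaryGroup
open Literature.NumberTheory.Rogawski1990 Literature.NumberTheory.GaloisRepresentations
open Literature.NumberTheory.Automorphic.UnitaryThreeFourFrame
open Literature.NumberTheory.Automorphic.UnitaryLatticeTree Literature.NumberTheory.Automorphic.HermitianLattice
open scoped Matrix MatrixGroups Classical ValuativeRel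

variable (L : Type) [Field L] [NumberField L] [IsCMField L] {v : HeightOneSpectrum (𝓞 ↥(maximalRealSubfield L))}
  (w : UnitaryGroup.PlacesOver L v) (hw : IsCMField.complexConj L • w.1 = w.1)

/-! ## §1  The orbit dictionary at rank 2: fixed cosets of `U₂(L⁺_v) ⧸ K₂` = `γ`-fixed members of the orbit `ι_w(U₂)·𝒪_w²` -/

/-- **`u ∈ K₂ = U(Φ₂)(𝒪_v) ⟺ ι_w(u)·𝒪_w² = 𝒪_w²`** at a non-split place: the level clause of the one-place model (★ `mem_localIntegralLevel_iff_of_smul_eq`: `u ∈ K₂ ↔ ι_w u ∈ GL₂(𝒪_w)`)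
and the root stabiliser in `GL₂(E_w)` (★ `mapGL_stdLattice_eq_iff_mem_glInt`). [cite: PlatonovRapinchuk1994, §5.1] [cite: Kottwitz1986BaseChangeUnits, §3] -/
theorem mem_cmLocalIntegralLevel_two_iff_mapGL_stdLattice_eq (u : ((UnitaryGroup.cmDatum L 2 (Matrix.of fun i j : Fin 2 => if i.val + j.val + 1 = 2 then (1 : L) else 0)).Local v)) :
    u ∈ cmLocalIntegralLevel L 2 (Matrix.of fun i j : Fin 2 => if i.val + j.val + 1 = 2 then (1 : L) else 0) v ↔
      mapGL ((localNonsplitEquiv (IsCMField.complexConj L) (Matrix.of fun i j : Fin 2 => if i.val + j.val + 1 = 2 then (1 : L) else 0) (IsCMField.complexConj_ne_one L) w hw u :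
        ↥(unitaryGroupOfForm (galAdicCompletionMap (L := L) (IsCMField.complexConj L) hw) (placeForm (Matrix.of fun i j : Fin 2 => if i.val + j.val + 1 = 2 then (1 : L) else 0) w.1))) : GL (Fin 2) (w.1.adicCompletion L))
        (stdLattice (w.1.adicCompletion L) 2) = stdLattice (w.1.adicCompletion L) 2 := by
  rw [mapGL_stdLattice_eq_iff_mem_glInt]
  exact mem_localIntegralLevel_iff_of_smul_eq (IsCMField.complexConj L) 2 (Matrix.of fun i j : Fin 2 => if i.val + j.val + 1 = 2 then (1 : L) else 0) (IsCMField.complexConj_ne_one L) w hw u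

/-- **`#Fix_γ(U₂(L⁺_v) ⧸ K₂) = #{B ⊂ E_w² | B ∈ ι_w(U₂(L⁺_v))·𝒪_w² ∧ ι_w(γ)·B = B}`** for every `γ ∈ U₂(L⁺_v)` at a non-split place `w ∣ v` (`Set.ncard`; both sides `0` if infinite):
★ Kottwitz's orbit dictionary `natCard_fixedBy_quotient_eq_ncard_orbit` at `ι_w = localNonsplitEquiv`, root `𝒪_w²`, level `K₂ = cmLocalIntegralLevel` (§1 above).  No transitivity,
no datum, no `|2| = 1`. [cite: Kottwitz1986BaseChangeUnits, §3] [cite: Rogawski1990, §4.9 Prop. 4.9.1 (b) p. 55] -/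
theorem natCard_fixedBy_quotient_cmLocalIntegralLevel_two_eq_ncard_orbit (γ : ((UnitaryGroup.cmDatum L 2 (Matrix.of fun i j : Fin 2 => if i.val + j.val + 1 = 2 then (1 : L) else 0)).Local v)) :
    Nat.card (MulAction.fixedBy (((UnitaryGroup.cmDatum L 2 (Matrix.of fun i j : Fin 2 => if i.val + j.val + 1 = 2 then (1 : L) else 0)).Local v) ⧸ cmLocalIntegralLevel L 2 (Matrix.of fun i j : Fin 2 => if i.val + j.val + 1 = 2 then (1 : L) else 0) v) γ) =
      {B : Submodule (Valued.integer (w.1.adicCompletion L)) (Fin 2 → (w.1.adicCompletion L)) |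
        (∃ u : ((UnitaryGroup.cmDatum L 2 (Matrix.of fun i j : Fin 2 => if i.val + j.val + 1 = 2 then (1 : L) else 0)).Local v),
          mapGL ((localNonsplitEquiv (IsCMField.complexConj L) (Matrix.of fun i j : Fin 2 => if i.val + j.val + 1 = 2 then (1 : L) else 0) (IsCMField.complexConj_ne_one L) w hw u :
            ↥(unitaryGroupOfForm (galAdicCompletionMap (L := L) (IsCMField.complexConj L) hw) (placeForm (Matrix.of fun i j : Fin 2 => if i.val + j.val + 1 = 2 then (1 : L) else 0) w.1))) : GL (Fin 2) (w.1.adicCompletion L))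
            (stdLattice (w.1.adicCompletion L) 2) = B) ∧
        mapGL ((localNonsplitEquiv (IsCMField.complexConj L) (Matrix.of fun i j : Fin 2 => if i.val + j.val + 1 = 2 then (1 : L) else 0) (IsCMField.complexConj_ne_one L) w hw γ :
          ↥(unitaryGroupOfForm (galAdicCompletionMap (L := L) (IsCMField.complexConj L) hw) (placeForm (Matrix.of fun i j : Fin 2 => if i.val + j.val + 1 = 2 then (1 : L) else 0) w.1))) : GL (Fin 2) (w.1.adicCompletion L)) B = B}.ncard := by
  -- `ι_w` as a monoid homomorphism `U₂(L⁺_v) →* GL₂(E_w)` (the statement's coercion, by `rfl`)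
  let ι : ((UnitaryGroup.cmDatum L 2 (Matrix.of fun i j : Fin 2 => if i.val + j.val + 1 = 2 then (1 : L) else 0)).Local v) →* GL (Fin 2) (w.1.adicCompletion L) :=
    (Subgroup.subtype _).comp (localNonsplitEquiv (IsCMField.complexConj L) (Matrix.of fun i j : Fin 2 => if i.val + j.val + 1 = 2 then (1 : L) else 0) (IsCMField.complexConj_ne_one L) w hw).toMulEquiv.toMonoidHom
  have hιe : ∀ u : ((UnitaryGroup.cmDatum L 2 (Matrix.of fun i j : Fin 2 => if i.val + j.val + 1 = 2 then (1 : L) else 0)).Local v),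
      ι u = ((localNonsplitEquiv (IsCMField.complexConj L) (Matrix.of fun i j : Fin 2 => if i.val + j.val + 1 = 2 then (1 : L) else 0) (IsCMField.complexConj_ne_one L) w hw u :
        ↥(unitaryGroupOfForm (galAdicCompletionMap (L := L) (IsCMField.complexConj L) hw) (placeForm (Matrix.of fun i j : Fin 2 => if i.val + j.val + 1 = 2 then (1 : L) else 0) w.1))) : GL (Fin 2) (w.1.adicCompletion L)) :=
    fun _ => rfl
  have hKt : ∀ u : ((UnitaryGroup.cmDatum L 2 (Matrix.of fun i j : Fin 2 => if i.val + j.val + 1 = 2 then (1 : L) else 0)).Local v),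
      u ∈ cmLocalIntegralLevel L 2 (Matrix.of fun i j : Fin 2 => if i.val + j.val + 1 = 2 then (1 : L) else 0) v ↔ mapGL (ι u) (stdLattice (w.1.adicCompletion L) 2) = stdLattice (w.1.adicCompletion L) 2 :=
    fun u => by rw [hιe]; exact mem_cmLocalIntegralLevel_two_iff_mapGL_stdLattice_eq L w hw u
  rw [natCard_fixedBy_quotient_eq_ncard_orbit ι (stdLattice (w.1.adicCompletion L) 2) _ hKt γ]
  simp only [hιe]

/-! ## §2  HEAD: `#Fix_γ(U₂(L⁺_v) ⧸ K₂)` = the number of `γ`-fixed EVEN self-dual lattices of `(E_w², J₂)` -/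

/-- **O-Hside LEAN LEG — `#Fix_γ(U₂(L⁺_v) ⧸ K₂) = #{B ⊂ E_w² | B self-dual ∧ B even ∧ ι_w(γ)·B = B}`.**  At a non-split place `w ∣ v` of the CM field `L` (`σ_w` = complex conjugation on
`E_w = L_w`), for a uniformiser `ϖ` of `E_w` and EVERY `γ ∈ U₂(L⁺_v)`: the number of `γ`-fixed cosets of the integral level `K₂ = U(Φ₂)(𝒪_v)` (the H-side token of (ρ2b′-X) :418,
★ p856225 §3) equals the number of lattices `B ⊂ E_w²` which are SELF-DUAL for `(σ_w, ϖ, J₂)` (`J₂ = antidiag(1,1) = (Φ₂)_w`), EVEN (`∀ y ∈ B, ⟨y,y⟩ = s + σ_w s` with `|s| ≤ 1` —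
at a wildly ramified place a genuine condition: `Tr 𝒪_w ⊊ 𝒪_v`) and fixed by `ι_w(γ)`.  §1 + ★ `setOf_orbit_stdLattice_two_eq_setOf_isSelfDualLattice_even` (the orbit `U(σ_w,J₂)·𝒪_w²`
is the even self-dual lattices: Jacobowitz Prop. 9.1 at `i = 0`, 2-free) at the ONTO model `ι_w` (★ `coe_localNonsplitEquiv_two_mem`, ★ `placeForm_antidiagTwo_eq_over`), with `σ_w² = 1`
(★ `galAdicCompletionMap_galAdicCompletionMap_of_smul_eq`) and `|σ_w ·| = |·|` (★ `valued_galAdicCompletionMap`).  No ramification hypothesis, no `|2| = 1`, no `d`.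
[cite: Kottwitz1986BaseChangeUnits, §3] [cite: Rogawski1990, §4.9 Prop. 4.9.1 (b) p. 55, Lemma 4.9.3 p. 56] [cite: Jacobowitz1962, §9 Prop. 9.1] [cite: PlatonovRapinchuk1994, §5.1] -/
theorem natCard_fixedBy_quotient_cmLocalIntegralLevel_two_eq_ncard_even_selfDual_fixed
    {ϖ : w.1.adicCompletion L} (hϖ : Valued.v ϖ = WithZero.exp (-1 : ℤ))
    (γ : ((UnitaryGroup.cmDatum L 2 (Matrix.of fun i j : Fin 2 => if i.val + j.val + 1 = 2 then (1 : L) else 0)).Local v)) :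
    Nat.card (MulAction.fixedBy (((UnitaryGroup.cmDatum L 2 (Matrix.of fun i j : Fin 2 => if i.val + j.val + 1 = 2 then (1 : L) else 0)).Local v) ⧸ cmLocalIntegralLevel L 2 (Matrix.of fun i j : Fin 2 => if i.val + j.val + 1 = 2 then (1 : L) else 0) v) γ) =
      {B : Submodule (Valued.integer (w.1.adicCompletion L)) (Fin 2 → (w.1.adicCompletion L)) |
        IsSelfDualLattice (galAdicCompletionMap (L := L) (IsCMField.complexConj L) hw) ϖ ((StdForm.antidiagonal 2).over (w.1.adicCompletion L)) B ∧
        (∀ y ∈ B, ∃ s : w.1.adicCompletion L, Valued.v s ≤ 1 ∧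
          pairing (galAdicCompletionMap (L := L) (IsCMField.complexConj L) hw) ((StdForm.antidiagonal 2).over (w.1.adicCompletion L)) y y = s + (galAdicCompletionMap (L := L) (IsCMField.complexConj L) hw) s) ∧
        mapGL ((localNonsplitEquiv (IsCMField.complexConj L) (Matrix.of fun i j : Fin 2 => if i.val + j.val + 1 = 2 then (1 : L) else 0) (IsCMField.complexConj_ne_one L) w hw γ :
          ↥(unitaryGroupOfForm (galAdicCompletionMap (L := L) (IsCMField.complexConj L) hw) (placeForm (Matrix.of fun i j : Fin 2 => if i.val + j.val + 1 = 2 then (1 : L) else 0) w.1))) : GL (Fin 2) (w.1.adicCompletion L)) B = B}.ncard := by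
  have hc1 : IsCMField.complexConj L ≠ 1 := IsCMField.complexConj_ne_one L
  have hpf : placeForm (Matrix.of fun i j : Fin 2 => if i.val + j.val + 1 = 2 then (1 : L) else 0) w.1 = (StdForm.antidiagonal 2).over (w.1.adicCompletion L) :=
    placeForm_antidiagTwo_eq_over L w
  -- `ι_w` as a monoid homomorphism (the statement's coercion, by `rfl`), landing in and onto `U(σ_w, J₂)`
  let ι : ((UnitaryGroup.cmDatum L 2 (Matrix.of fun i j : Fin 2 => if i.val + j.val + 1 = 2 then (1 : L) else 0)).Local v) →* GL (Fin 2) (w.1.adicCompletion L) :=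
    (Subgroup.subtype _).comp (localNonsplitEquiv (IsCMField.complexConj L) (Matrix.of fun i j : Fin 2 => if i.val + j.val + 1 = 2 then (1 : L) else 0) hc1 w hw).toMulEquiv.toMonoidHom
  have hιe : ∀ u : ((UnitaryGroup.cmDatum L 2 (Matrix.of fun i j : Fin 2 => if i.val + j.val + 1 = 2 then (1 : L) else 0)).Local v),
      ι u = ((localNonsplitEquiv (IsCMField.complexConj L) (Matrix.of fun i j : Fin 2 => if i.val + j.val + 1 = 2 then (1 : L) else 0) (IsCMField.complexConj_ne_one L) w hw u :
        ↥(unitaryGroupOfForm (galAdicCompletionMap (L := L) (IsCMField.complexConj L) hw) (placeForm (Matrix.of fun i j : Fin 2 => if i.val + j.val + 1 = 2 then (1 : L) else 0) w.1))) : GL (Fin 2) (w.1.adicCompletion L)) :=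
    fun _ => rfl
  have hι : ∀ u : ((UnitaryGroup.cmDatum L 2 (Matrix.of fun i j : Fin 2 => if i.val + j.val + 1 = 2 then (1 : L) else 0)).Local v),
      ι u ∈ unitaryGroupOfForm (galAdicCompletionMap (L := L) (IsCMField.complexConj L) hw) ((StdForm.antidiagonal 2).over (w.1.adicCompletion L)) :=
    fun u => by rw [hιe]; exact coe_localNonsplitEquiv_two_mem L w hw u
  have hιonto : ∀ u : GL (Fin 2) (w.1.adicCompletion L), u ∈ unitaryGroupOfForm (galAdicCompletionMap (L := L) (IsCMField.complexConj L) hw) ((StdForm.antidiagonal 2).over (w.1.adicCompletion L)) →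
      ∃ g : ((UnitaryGroup.cmDatum L 2 (Matrix.of fun i j : Fin 2 => if i.val + j.val + 1 = 2 then (1 : L) else 0)).Local v), ι g = u := by
    intro u hu
    have hu' : u ∈ unitaryGroupOfForm (galAdicCompletionMap (L := L) (IsCMField.complexConj L) hw) (placeForm (Matrix.of fun i j : Fin 2 => if i.val + j.val + 1 = 2 then (1 : L) else 0) w.1) := by
      rw [hpf]; exact hu
    refine ⟨(localNonsplitEquiv (IsCMField.complexConj L) (Matrix.of fun i j : Fin 2 => if i.val + j.val + 1 = 2 then (1 : L) else 0) hc1 w hw).symm ⟨u, hu'⟩, ?_⟩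
    rw [hιe, ContinuousMulEquiv.apply_symm_apply]
  have hset := setOf_orbit_stdLattice_two_eq_setOf_isSelfDualLattice_even
    (fun x => galAdicCompletionMap_galAdicCompletionMap_of_smul_eq (IsCMField.complexConj L) w hc1 hw x)
    (fun a => valued_galAdicCompletionMap (L := L) (IsCMField.complexConj L) hw a) hϖ ι hι hιonto
    (fun B => mapGL ((localNonsplitEquiv (IsCMField.complexConj L) (Matrix.of fun i j : Fin 2 => if i.val + j.val + 1 = 2 then (1 : L) else 0) (IsCMField.complexConj_ne_one L) w hw γ :
          ↥(unitaryGroupOfForm (galAdicCompletionMap (L := L) (IsCMField.complexConj L) hw) (placeForm (Matrix.of fun i j : Fin 2 => if i.val + j.val + 1 = 2 then (1 : L) else 0) w.1))) : GL (Fin 2) (w.1.adicCompletion L)) B = B)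
  simp only [hιe] at hset
  rw [natCard_fixedBy_quotient_cmLocalIntegralLevel_two_eq_ncard_orbit L w hw γ, hset]

end Summit.HodgeConjecture.HodgeConjecture.Cruxes.H413.F0P3cDyRamHSideLatticeCount

end
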